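import Mathlib
import HarnessLib
import Summits.BirchSwinnertonDyer.BirchSwinnertonDyer.Theses.ManinLocalTwoThree
import Summits.BirchSwinnertonDyer.BirchSwinnertonDyer.Theorems.ManinLocalTwoThreeThirdingCoverUDC
import Literature.NumberTheory.Automorphic.UnboundedDenominators

/-!
# Lines/thirding_udc.lean — v1 (lead p1 gen 18, 2026-08-29T23:4xZ): THE THIRDING LINE FOR C3 — Unbounded Denominators on the 3-DIVISION COVER of φ₀.
# (LEAD-MEMO v38; kernel `Theorems/ManinLocalTwoThreeThirdingCoverUDC.lean`, p751178.)  For a lattice-optimal datum at 9 ∣ N with 3 ∣ c: the third point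
# Q = (c/3)·E_f is modular for exactly Γ^{(3)} = per⁻¹(3Λ₀) (finite index, normal, type II), NONCONGRUENCE unless Λ₁ = 3Λ₀ — which NEVER happens
# (tree `not_periodLatticeGamma1_eq_three_mul_periodLattice`); t(Q) ∈ ℤ⟦q⟧ by Honda at the integer c/3; a pole-cleared multiple is the THIRDING WITNESS;
# CDT ⟹ congruence ⟹ contradiction.  COMPOSITION `Thirding.maninPrimeToThreeAtNine_of_CDT_thirdingWitnessLaw`.
# STUBS (2): `stub_CDT_algInt` (PRINTED, cite-only) · `stub_thirdingWitnessLaw` (OPEN analytic bookkeeping — the p = 3 port of the landed ℓ = 3 Kummer witness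
# B-line (INT)/(DICT)/(RATB)/(HOLB)/(QEXNB)/(INVB)/(WL♭) from W_u(c·E_f) to t((c/3)·E_f)).  Versus kato_shift_three v34 (six PRINTED stubs KP, CDT, F★₀, F★, F♮, CES):
# the five Kato/cusp facts are REPLACED by one analytic stub with a complete paper proof and landed templates.  NO 3-torsion hypothesis, no index law.
# HONEST FRAMING: CONDITIONAL reduction; the witness law is OPEN; CDT printed only; BSD is not proved; Manin's conjecture at 3 is not proved.
-/

set_option autoImplicit false
set_option linter.dupNamespace false

noncomputable section

open scoped MatrixGroups ModularForm Manifold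
open CongruenceSubgroup WeierstrassCurve Literature.NumberTheory.EllipticCurves Literature.NumberTheory.EllipticCurves.ModularForms

namespace Summit.BirchSwinnertonDyer.BirchSwinnertonDyer.Cruxes.ManinPrimeToThreeAtNine.ThirdingUDC

/-- STUB (PRINTED) CDT-algInt — Calegari–Dimitrov–Tang 2025 Thm. 1.0.1 with Remarks 58–59; CITE-ONLY. -/
theorem stub_CDT_algInt : Literature.NumberTheory.Automorphic.CalegariDimitrovTang2025_unboundedDenominators_algInt := by
  sorry

/-- STUB (OPEN, analytic bookkeeping) — THE THIRDING WITNESS LAW: for every lattice-optimal datum at `9 ∣ N` of a globally minimal curve with `3 ∣ c` there is a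
holomorphic `F : ℍ → ℂ` of some weight `k` whose `Γ₀(N)`-stabiliser is EXACTLY the thirding cover group `{γ : c{∞,γ∞}_f ∈ 3Λ_W}`, with exponential growth at every
cusp and an algebraic-integer `q`-expansion.  Paper proof: `F = t(Q)·B_d·f^a·Δ^m`, `Q = (c/3)·E_f`; Honda at `c/3`; `B_d` kills the poles of `t(Q)` (over `φ⁻¹(E[2])∪…`
inside `ℍ`); stabiliser exactness: `t(Q + T) ≡ t(Q)` forces `T = O` for `T ∈ E[3] ∖ O`. -/
theorem stub_thirdingWitnessLaw :
    ∀ (W : WeierstrassCurve ℚ) [W.IsElliptic] [W.IsGloballyMinimal] {N : ℕ} [NeZero N] (D : ModularParametrizationData W N),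
      3 ^ 2 ∣ N → (∀ z ∈ D.L.lattice, ∃ w ∈ periodLattice D.f, z = D.c * w) → (3 : ℤ) ∣ D.c →
      ∃ (k : ℤ) (F : UpperHalfPlane → ℂ), MDifferentiable 𝓘(ℂ) 𝓘(ℂ) F ∧
        (∀ γ : Gamma0 N, (∃ ν ∈ D.L.lattice, (D.c : ℂ) * cuspSymbol D.f γ = 3 * ν) → F ∣[k] (γ : SL(2, ℤ)) = F) ∧
        (∀ γ : Gamma0 N, F ∣[k] (γ : SL(2, ℤ)) = F → ∃ ν ∈ D.L.lattice, (D.c : ℂ) * cuspSymbol D.f γ = 3 * ν) ∧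
        (∀ g : SL(2, ℤ), ∃ C A m : ℝ, ∀ τ : UpperHalfPlane, A ≤ τ.im → ‖(F ∣[k] g) τ‖ ≤ C * Real.exp (m * τ.im)) ∧
        (∃ b : ℕ → ℂ, (∀ n, IsIntegral ℤ (b n)) ∧ ∀ τ : UpperHalfPlane,
          HasSum (fun n : ℕ ↦ b n * Complex.exp (2 * Real.pi * Complex.I * (τ : ℂ) * n)) (F τ)) := by
  sorry

/-- COMPOSITION (no sorry): `Thirding.maninPrimeToThreeAtNine_of_CDT_thirdingWitnessLaw` (LEAD p1 g18, p751178). -/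
theorem ManinPrimeToThreeAtNine_of :
    Summit.BirchSwinnertonDyer.BirchSwinnertonDyer.Theses.ManinLocalTwoThree.ManinPrimeToThreeAtNine :=
  Summit.BirchSwinnertonDyer.BirchSwinnertonDyer.Theorems.ManinLocalTwoThree.Thirding.maninPrimeToThreeAtNine_of_CDT_thirdingWitnessLaw
    stub_CDT_algInt stub_thirdingWitnessLaw

end Summit.BirchSwinnertonDyer.BirchSwinnertonDyer.Cruxes.ManinPrimeToThreeAtNine.ThirdingUDC

end
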